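import Summits.QuantumFields.YangMills.Theorems.FemtoTransferGapRungW1upAlgebra
import HarnessLib

/-!
# Crux RED, line «KTR» rev 7 PART 5 «TT» (twisted trace): the zero-flux trace objects — definitions

Support DEFINITIONS (nothing asserted, no route import) for crux `RunningReduction` (route `LuscherReduction`, item stmt-QuantumFields-19978), line «KTR»
rev 7 registered by the owner ym-beyond-p1 g18 (2026-08-27, `pub/ym-beyond/p1-g18-files/Lines-KTR-r7.lean` sha16 d855a771aaa97229, PART 5 §1; card
`Lines-KTR-r7.md`).  VERBATIM the objects of PART 5 §1 that the registered stub `TT.stub_traceFormula` speaks of, moved to the Theorems side so that prover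
files (which cannot import `Cruxes/…`) can prove the trace formula over TREE constants — the same device as `…ExplicitNoIntruderDefs` / `…KTDefs`;
the centre element `negOne` is the tree's `FemtoTransferGapRungW1upAlgebra.negOne` (same term `⟨−1, _⟩`, so every body below is definitionally the
skeleton's); fleet service by seat ym-infvol-p2:

* `centreElem b` — the centre element of `SU(2)` labelled by a bit; `twist3 z` — the composite centre twist through the three planes `x_k = 0`;
* `gaugeMeasure L` — Haar probability on the gauge group `SU(2)^{sites}`;
* `physAvg f U = (1/8) Σ_{z ∈ (ℤ/2)³} ∫ f(g · tw_z U) dg` — the physical (Gauss law × zero electric flux) average on a kernel slot;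
* `physTraceSucc L β n = Z_phys(L, β, n+1) = Tr (P K_β)^{n+1}` — the CLOSED CHAIN of `n+1` transfer kernels on `n+1` time slices with the physical average
  on the seam; `physTrace L β T = physTraceSucc L β (T − 1)`.

The trace formula `HasSum (k ↦ λ_k^T) (physTrace L β T)` (`T ≥ 2`, `β ≥ 1`) is proved in the companion files (`FemtoTransferGapEigenbasis`, `…PhysAvg`,
`…TraceFormula`).

HONEST FRAMING: femto-universe rung R2b1 vocabulary at fixed lattice; nothing here is infinite volume, a mass gap or Clay.
References: [cite: Luscher1983, §2]; I. Montvay, G. Münster (1994) (3.145) [cite: MontvayMunster1994].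
-/

set_option autoImplicit false

noncomputable section

open MeasureTheory
open Literature.MathematicalPhysics.QuantumFieldTheory
open Literature.MathematicalPhysics.QuantumLattice
open scoped BigOperators

namespace Summit.QuantumFields.YangMills.Theorems.FemtoTransferGap

/-- Centre element of `SU(2)` labelled by a bit (`ℤ/2 ≅ Z(SU(2))`; `true ↦ −1`). VERBATIM «KTR» rev 7 PART 5 §1. [cite: Luscher1983, §2] -/
def centreElem (b : Bool) : SU2 := if b then negOne else 1

/-- The composite centre twist `z ∈ (ℤ/2)³` through the three planes `x_k = 0` (tree `twist`). VERBATIM «KTR» rev 7 PART 5 §1. [cite: Luscher1983, §2] -/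
def twist3 {L : ℕ} (z : Fin 3 → Bool) (U : GaugeConfig 3 L SU2) : GaugeConfig 3 L SU2 :=
  twist 0 (centreElem (z 0)) (twist 1 (centreElem (z 1)) (twist 2 (centreElem (z 2)) U))

/-- Haar probability on the gauge group `SU(2)^{sites}` of the spatial torus `(ℤ/L)³`. VERBATIM «KTR» rev 7 PART 5 §1. [folklore] -/
def gaugeMeasure (L : ℕ) [NeZero L] : Measure (Site 3 L → SU2) :=
  Measure.pi fun _ : Site 3 L => haarProbability SU2

/-- **Physical average** `(P f)(U) = (1/8) Σ_{z ∈ (ℤ/2)³} ∫ f(g · tw_z U) dg`: the orthogonal projection of `L²(configMeasure)` onto the physical zero-flux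
functions (Gauss law × electric flux `e = 0`), written on a kernel slot. VERBATIM «KTR» rev 7 PART 5 §1. [cite: Luscher1983, §2] -/
def physAvg {L : ℕ} [NeZero L] (f : GaugeConfig 3 L SU2 → ℝ) (U : GaugeConfig 3 L SU2) : ℝ :=
  (1 / 8 : ℝ) * ∑ z : Fin 3 → Bool, ∫ g, f (gaugeTransform g (twist3 z U)) ∂(gaugeMeasure L)

/-- **Zero-flux trace of `n+1` transfer steps** `Z_phys(L, β, n+1) = Tr (P K_β)^{n+1}`: a CLOSED CHAIN of `n+1` kernels on `n+1` time slices, the seam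
`U_n → U_0` carrying the physical average. VERBATIM «KTR» rev 7 PART 5 §1. [cite: MontvayMunster1994, (3.145)] -/
def physTraceSucc (L : ℕ) [NeZero L] (β : ℝ) (n : ℕ) : ℝ :=
  ∫ Us : Fin (n + 1) → GaugeConfig 3 L SU2,
    (∏ i : Fin n, transferKernel su2Rep β (Us i.castSucc) (Us i.succ)) *
      physAvg (transferKernel su2Rep β (Us (Fin.last n))) (Us 0)
    ∂(Measure.pi fun _ : Fin (n + 1) => configMeasure SU2 L)

/-- `Z_phys(L, β, T)` for `T ≥ 1` time steps (`T = 0` ↦ the one-step value, a junk convention never used). VERBATIM «KTR» rev 7 PART 5 §1.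
[cite: MontvayMunster1994, (3.145)] -/
def physTrace (L : ℕ) [NeZero L] (β : ℝ) (T : ℕ) : ℝ := physTraceSucc L β (T - 1)

end Summit.QuantumFields.YangMills.Theorems.FemtoTransferGap

end
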